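import Mathlib.LinearAlgebra.LinearIndependent.Defs
import Mathlib.LinearAlgebra.Finsupp.LinearCombination
import Mathlib.Algebra.BigOperators.GroupWithZero.Finset
import Mathlib.Algebra.GroupWithZero.Basic
import Mathlib.Algebra.Field.Basic
import Mathlib.Data.Int.GCD
import Mathlib.Tactic
import HarnessLib

/-!
# Cell abc-stewartyu, Gen-3 frames: multiplicative independence and the `q`-Kummer condition under a
# change of basis of the generators (Matveev's step), with `q`-saturation

`Summits/ABC/StewartYu/KummerBasisChange.lean` — cell `abc-stewartyu` (route `PadicPrimesKummerThird`, cruxes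
`Y07Odd` stmt-ABC-19658 / `Y07Two` stmt-ABC-19659), seat p3 (g4), F-two lead; brick (c) of HOME/p3/memo-08 §5.
Theorems only, pure lattice algebra over a field `K` (place-free).

After the zero estimate and the lattice lever, Matveev's induction (Nesterenko 2003, Prop. 2.6; Yu 2013 §2,
"basic hypothesis") replaces the generators `α₁, …, αₘ` by `θᵢ = ∏ⱼ αⱼ^{zᵢⱼ}` for `ν` independent integer
rows `zᵢ ∈ ℤᵐ`.  The Gen-3 engine texts (`GenThreeEngineOdd` / `GenThreeEngineTwo`) carry two hypotheses
that must survive this step inside the induction: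

* MULTIPLICATIVE INDEPENDENCE survives (`mulIndep_basisChange`): `∏ θᵢ^{μᵢ} = 1 ⇒ μ = 0` from the same for
  `α` and the independence of the rows (`∏ᵢ θᵢ^{κᵢ} = ∏ⱼ αⱼ^{∑ᵢ κᵢ zᵢⱼ}`, `prod_zpow_basisChange`) — this feeds
  the orbit count `GenThreeVanishing.ncard_image_mk_zpowSet` at every induction level;
* the `q`-KUMMER condition (`∏ αⱼ^{φⱼ} = γ^q ⇒ q ∣ φ`) does NOT survive in general (`α₁^q` is a `q`-th power);
  it does as soon as the row lattice `Λ = ∑ ℤ zᵢ` is `q`-SATURATED in `ℤᵐ` (`q·v ∈ Λ ⇒ v ∈ Λ`):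
  `kummer_basisChange`.  This is Yu's `q`-saturation step (Yu 2013 §5♣; lit SOURCES §22.6): the frame chooses
  the new basis inside the `q`-saturation of the lever's lattice;
* for the `p = 2` text, whose cube-Kummer hypothesis is stated on `ℕ`-exponents in contrapositive form
  (`(∃ j, ¬ 3 ∣ κⱼ) → ∏ αⱼ^{κⱼ} ≠ γ³`), the two forms are interchanged by `kummerInt_of_kummerNat` /
  `kummerNat_of_kummerInt` (reduce `φ ∈ ℤᵐ` to `φ⁺ + (q−1)φ⁻ ∈ ℕᵐ`), so `cubeKummer_basisChange` transports the
  frozen `GenThreeEngineTwo` hypothesis verbatim.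

References: Yu. V. Nesterenko, LNM 1819 (2003), Prop. 2.6 and Cor. 4.5 (the Kummer condition for a lattice
basis); K. Yu, *p-adic logarithmic forms and a problem of Erdős*, Acta Math. 211 (2013), §2, §5.
-/

open Finset

namespace Summit.ABC.StewartYu.KummerBasisChange

variable {K : Type*} [Field K] {m ν : ℕ}

/-- `a^{∑ fᵢ} = ∏ a^{fᵢ}` for a nonzero element of a field. [folklore] -/
theorem zpow_sum₀ {a : K} (ha : a ≠ 0) {ι : Type*} (s : Finset ι) (f : ι → ℤ) :
    a ^ (∑ i ∈ s, f i) = ∏ i ∈ s, a ^ f i := by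
  classical
  induction s using Finset.induction_on with
  | empty => simp
  | insert i s hi ih => rw [Finset.sum_insert hi, Finset.prod_insert hi, zpow_add₀ ha, ih]

/-- **Monomials in the new basis are monomials in the old one**: for `θᵢ = ∏ⱼ αⱼ^{zᵢⱼ}`,
`∏ᵢ θᵢ^{κᵢ} = ∏ⱼ αⱼ^{∑ᵢ κᵢ zᵢⱼ}`. [cite: Nesterenko2003, Prop 2.6 (2.10)] -/
theorem prod_zpow_basisChange (α : Fin m → K) (hα : ∀ j, α j ≠ 0) (Z : Fin ν → Fin m → ℤ)
    (θ : Fin ν → K) (hθ : ∀ i, θ i = ∏ j, α j ^ Z i j) (κ : Fin ν → ℤ) :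
    ∏ i, θ i ^ κ i = ∏ j, α j ^ (∑ i, κ i * Z i j) := by
  calc ∏ i, θ i ^ κ i = ∏ i, ∏ j, (α j ^ Z i j) ^ κ i := by
        refine Finset.prod_congr rfl fun i _ => ?_
        rw [hθ i, ← Finset.prod_zpow]
    _ = ∏ j, ∏ i, (α j ^ Z i j) ^ κ i := Finset.prod_comm
    _ = ∏ j, α j ^ (∑ i, κ i * Z i j) := by
        refine Finset.prod_congr rfl fun j _ => ?_
        rw [zpow_sum₀ (hα j)]
        refine Finset.prod_congr rfl fun i _ => ?_
        rw [← zpow_mul, mul_comm]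

/-- The new generators are nonzero. [folklore] -/
theorem basisChange_ne_zero (α : Fin m → K) (hα : ∀ j, α j ≠ 0) (Z : Fin ν → Fin m → ℤ)
    (θ : Fin ν → K) (hθ : ∀ i, θ i = ∏ j, α j ^ Z i j) (i : Fin ν) : θ i ≠ 0 := by
  rw [hθ i]
  exact Finset.prod_ne_zero_iff.mpr fun j _ => zpow_ne_zero _ (hα j)

/-- Independent integer rows: `∑ᵢ κᵢ zᵢ = 0 ⇒ κ = 0`, coordinatewise form. [folklore] -/
theorem eq_zero_of_sum_mul_rows_eq_zero (Z : Fin ν → Fin m → ℤ) (hZ : LinearIndependent ℤ Z)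
    (κ : Fin ν → ℤ) (h : ∀ j, ∑ i, κ i * Z i j = 0) : κ = 0 := by
  have h' : ∑ i, κ i • Z i = 0 := by
    funext j
    simp only [Finset.sum_apply, Pi.smul_apply, smul_eq_mul, Pi.zero_apply]
    exact h j
  funext i
  exact Fintype.linearIndependent_iff.mp hZ κ h' i

/-- **Multiplicative independence survives the change of basis**: if `∏ αⱼ^{φⱼ} = 1 ⇒ φ = 0` and the rows
`zᵢ` are `ℤ`-independent, then `∏ θᵢ^{μᵢ} = 1 ⇒ μ = 0` for `θᵢ = ∏ αⱼ^{zᵢⱼ}`.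
[cite: Nesterenko2003, Prop 2.6] -/
theorem mulIndep_basisChange (α : Fin m → K) (hα : ∀ j, α j ≠ 0)
    (hind : ∀ φ : Fin m → ℤ, ∏ j, α j ^ φ j = 1 → φ = 0)
    (Z : Fin ν → Fin m → ℤ) (hZ : LinearIndependent ℤ Z)
    (θ : Fin ν → K) (hθ : ∀ i, θ i = ∏ j, α j ^ Z i j) :
    ∀ μ : Fin ν → ℤ, ∏ i, θ i ^ μ i = 1 → μ = 0 := by
  intro μ hμ
  rw [prod_zpow_basisChange α hα Z θ hθ μ] at hμ
  have h0 := hind _ hμ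
  exact eq_zero_of_sum_mul_rows_eq_zero Z hZ μ fun j => congrFun h0 j

/-- **The `q`-Kummer condition survives a change of basis inside a `q`-saturated lattice**: if
`∏ αⱼ^{φⱼ} = γ^q ⇒ q ∣ φⱼ` for all `φ ∈ ℤᵐ`, the rows `zᵢ` are `ℤ`-independent, and their span `Λ` is
`q`-saturated (`q·v ∈ Λ ⇒ v ∈ Λ`), then `∏ θᵢ^{κᵢ} = γ^q ⇒ q ∣ κᵢ` for `θᵢ = ∏ αⱼ^{zᵢⱼ}`.
[cite: Nesterenko2003, Cor 4.5] -/
theorem kummer_basisChange (q : ℕ) (α : Fin m → K) (hα : ∀ j, α j ≠ 0)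
    (hK : ∀ φ : Fin m → ℤ, (∃ γ : K, ∏ j, α j ^ φ j = γ ^ q) → ∀ j, (q : ℤ) ∣ φ j)
    (Z : Fin ν → Fin m → ℤ) (hZ : LinearIndependent ℤ Z)
    (hsat : ∀ v : Fin m → ℤ, (q : ℤ) • v ∈ Submodule.span ℤ (Set.range Z) →
      v ∈ Submodule.span ℤ (Set.range Z))
    (θ : Fin ν → K) (hθ : ∀ i, θ i = ∏ j, α j ^ Z i j) :
    ∀ κ : Fin ν → ℤ, (∃ γ : K, ∏ i, θ i ^ κ i = γ ^ q) → ∀ i, (q : ℤ) ∣ κ i := by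
  classical
  intro κ hκ
  obtain ⟨γ, hγ⟩ := hκ
  rw [prod_zpow_basisChange α hα Z θ hθ κ] at hγ
  -- `φ := ∑ κᵢ zᵢ` is divisible by `q` coordinatewise
  have hdiv : ∀ j, (q : ℤ) ∣ ∑ i, κ i * Z i j := hK _ ⟨γ, hγ⟩
  choose w hw using hdiv
  -- `q • w = φ ∈ Λ`, hence `w ∈ Λ` by saturation
  have hφmem : (fun j => ∑ i, κ i * Z i j) ∈ Submodule.span ℤ (Set.range Z) := by
    have : (fun j => ∑ i, κ i * Z i j) = ∑ i, κ i • Z i := by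
      funext j; simp [Finset.sum_apply]
    rw [this]
    exact Submodule.sum_mem _ fun i _ => Submodule.smul_mem _ _ (Submodule.subset_span ⟨i, rfl⟩)
  have hqw : (q : ℤ) • (fun j => w j) = fun j => ∑ i, κ i * Z i j := by
    funext j; simp [hw j]
  have hwmem : (fun j => w j) ∈ Submodule.span ℤ (Set.range Z) := hsat _ (by rw [hqw]; exact hφmem)
  obtain ⟨κ', hκ'⟩ := (Submodule.mem_span_range_iff_exists_fun ℤ).mp hwmem
  -- compare coefficients: `κ = q κ'`
  have hzero : (fun i => κ i - (q : ℤ) * κ' i) = 0 := by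
    refine eq_zero_of_sum_mul_rows_eq_zero Z hZ _ fun j => ?_
    have h1 : ∑ i, κ' i * Z i j = w j := by
      have := congrFun hκ' j
      simpa [Finset.sum_apply] using this
    have h2 : ∑ i, κ i * Z i j = (q : ℤ) * w j := hw j
    calc ∑ i, (κ i - (q : ℤ) * κ' i) * Z i j
        = ∑ i, κ i * Z i j - (q : ℤ) * ∑ i, κ' i * Z i j := by
          rw [Finset.mul_sum, ← Finset.sum_sub_distrib]
          refine Finset.sum_congr rfl fun i _ => ?_; ring
      _ = 0 := by rw [h2, h1, sub_self]
  intro i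
  have := congrFun hzero i
  simp only [Pi.zero_apply, sub_eq_zero] at this
  exact ⟨κ' i, this⟩

/-- From the `ℕ`-exponent contrapositive form of the `q`-Kummer condition (the shape of the frozen
`GenThreeEngineTwo` hypothesis, `q = 3`) to the `ℤ`-exponent divisibility form: reduce `φ ∈ ℤᵐ` to the
nonnegative exponent `φ⁺ + (q−1)φ⁻ ≡ φ (mod q)` by multiplying with the `q`-th power `(∏ αⱼ^{φⱼ⁻})^q`.
[folklore] -/
theorem kummerInt_of_kummerNat (q : ℕ) (hq : 1 ≤ q) (α : Fin m → K) (hα : ∀ j, α j ≠ 0)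
    (hN : ∀ κ : Fin m → ℕ, (∃ j, ¬ q ∣ κ j) → ∀ γ : K, ∏ j, α j ^ κ j ≠ γ ^ q) :
    ∀ φ : Fin m → ℤ, (∃ γ : K, ∏ j, α j ^ φ j = γ ^ q) → ∀ j, (q : ℤ) ∣ φ j := by
  intro φ hφ
  obtain ⟨γ, hγ⟩ := hφ
  -- nonnegative representative `κⱼ = φⱼ⁺ + (q-1) φⱼ⁻`
  set κ : Fin m → ℕ := fun j => (φ j).toNat + (q - 1) * (-φ j).toNat with hκ
  have hκφ : ∀ j, (κ j : ℤ) = φ j + (q : ℤ) * ((-φ j).toNat : ℤ) := by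
    intro j
    simp only [hκ, Nat.cast_add, Nat.cast_mul, Nat.cast_sub hq, Nat.cast_one]
    have h1 : ((φ j).toNat : ℤ) - ((-φ j).toNat : ℤ) = φ j := Int.toNat_sub_toNat_neg (φ j)
    linarith
  -- `∏ α^κ = (γ · ∏ α^{φ⁻})^q`
  have hprod : ∏ j, α j ^ κ j = (γ * ∏ j, α j ^ ((-φ j).toNat : ℤ)) ^ q := by
    rw [mul_pow, ← hγ, ← Finset.prod_pow, ← Finset.prod_mul_distrib]
    refine Finset.prod_congr rfl fun j _ => ?_
    rw [← zpow_natCast, hκφ j, zpow_add₀ (hα j), ← zpow_natCast, ← zpow_mul,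
      mul_comm (((-φ j).toNat : ℕ) : ℤ) (q : ℤ)]
  by_contra hnot
  push Not at hnot
  obtain ⟨j, hj⟩ := hnot
  have hjκ : ¬ q ∣ κ j := by
    intro hdvd
    apply hj
    have h1 : (q : ℤ) ∣ (κ j : ℤ) := by exact_mod_cast hdvd
    rw [hκφ j] at h1
    exact (dvd_add_left (dvd_mul_right _ _)).mp h1
  exact hN κ ⟨j, hjκ⟩ _ hprod

/-- From the `ℤ`-exponent divisibility form back to the `ℕ`-exponent contrapositive form. [folklore] -/
theorem kummerNat_of_kummerInt (q : ℕ) (α : Fin ν → K)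
    (hI : ∀ φ : Fin ν → ℤ, (∃ γ : K, ∏ j, α j ^ φ j = γ ^ q) → ∀ j, (q : ℤ) ∣ φ j) :
    ∀ κ : Fin ν → ℕ, (∃ j, ¬ q ∣ κ j) → ∀ γ : K, ∏ j, α j ^ κ j ≠ γ ^ q := by
  intro κ hκ γ hγ
  obtain ⟨j, hj⟩ := hκ
  apply hj
  have h := hI (fun j => (κ j : ℤ)) ⟨γ, by simpa [zpow_natCast] using hγ⟩ j
  exact_mod_cast h

/-- **The cube-Kummer hypothesis of `GenThreeEngineTwo` survives a change of basis inside a `3`-saturated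
lattice** (the shape the `p = 2` frame's induction needs): frozen-text form in, frozen-text form out.
[cite: Nesterenko2003, Cor 4.5] -/
theorem cubeKummer_basisChange (α : Fin m → K) (hα : ∀ j, α j ≠ 0)
    (hN : ∀ κ : Fin m → ℕ, (∃ j, ¬ 3 ∣ κ j) → ∀ γ : K, ∏ j, α j ^ κ j ≠ γ ^ 3)
    (Z : Fin ν → Fin m → ℤ) (hZ : LinearIndependent ℤ Z)
    (hsat : ∀ v : Fin m → ℤ, (3 : ℤ) • v ∈ Submodule.span ℤ (Set.range Z) →
      v ∈ Submodule.span ℤ (Set.range Z))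
    (θ : Fin ν → K) (hθ : ∀ i, θ i = ∏ j, α j ^ Z i j) :
    ∀ κ : Fin ν → ℕ, (∃ i, ¬ 3 ∣ κ i) → ∀ γ : K, ∏ i, θ i ^ κ i ≠ γ ^ 3 :=
  kummerNat_of_kummerInt 3 θ
    (kummer_basisChange 3 α hα (kummerInt_of_kummerNat 3 (by norm_num) α hα hN) Z hZ
      (by exact_mod_cast hsat) θ hθ)

end Summit.ABC.StewartYu.KummerBasisChange
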